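import Mathlib
import Summits.Ventures.HodgeRepro.Tier4.Common.AdelicDefs
import Summits.Ventures.HodgeRepro.Tier4.Line1.PlaneDefs
import Summits.Ventures.HodgeRepro.Tier4.Line1.StabLine
import Summits.Ventures.HodgeRepro.Tier4.Line1.TorusElement
import Summits.Ventures.HodgeRepro.Tier4.Line1.TorusPlaneData
import Summits.Ventures.HodgeRepro.Tier4.Line1.NormOneTorus
import Summits.Ventures.HodgeRepro.Tier4.Line1.CocompactReduction

/-!
# Tier4/Line1/TorusCocompact — (I1-c′)/(I1-c″): the tori `T`, `T′` of a genuine definite plane are cocompact modulo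
their rational points (the TORUS BRIDGE: hstab rung (ii) twice + `torus_scalar_of_isometry`)

Blind re-derivation cell `pub-hodge-repro`, Tier 4 (README §9–§10), seat t4-L1-p5 (prover, LINE L1, gen 2).
For a projector pair `P` of the plane (`P 0 + P 1 = 1`, idempotent, commuting with `Ω`, `B`-self-adjoint in the row
convention, rank `2` — the `P`- or `Q`-conjuncts of `PlaneData` + `IsGenuineRow`), the torus
`T = commutant (P 0) ⊓ commutant (P 1) ≤ U(W)(𝔸_k)` acts on the two rational `E′`-lines `im (P 0)`, `im (P 1)` by
norm-one scalars and is DETERMINED by them (`exists_pair_of_mem`, from `Rot.torus_scalar_of_isometry`); conversely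
every pair of norm-one scalars gives an element `torusElt` of `T` (`Rot.TorusData.tmat_props`), multiplicative in
the pair, rational for rational pairs and continuous.  Rung (ii) of `hstab` (`normOneTorusCocompact`: the norm-one
torus of `k(√−d)` is `T¹(k) · C` with `C` compact) applied to each of the two scalars writes every `g ∈ T` as
`torusElt γ · torusElt c` with `γ` rational and `c` in a compact set: R-c′ (`cocompact_rationalOf_commutant_pair`),
hence (I1-c′) for `torusT W` and (I1-c″) for `torusT' W` through p5-g0's reductions `torus_quotient_compact_of_cocompact`
/ `torus'_quotient_compact_of_cocompact` (CocompactReduction).  Mathlib + the line's modules only; no printed input.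

Nothing here says anything about the status of the Hodge conjecture for CM abelian varieties, which is NOT proved
(HC_CM is NOT proved by anyone in this repository).
-/

set_option autoImplicit false

noncomputable section

namespace Summit.Ventures.HodgeRepro.Tier4.Line1

open NumberField MeasureTheory Summit.Ventures.HodgeRepro.Tier4.Common Matrix Rot

variable {k : Type} [Field k] [NumberField k] (W : PlaneData k)

section Elements

variable {W}

/-- transport of a block scalar along a ring homomorphism -/
theorem blockScalar_map {R S : Type} [CommRing R] [CommRing S] (f : R →+* S) (d x y x' y' : R) :
    (blockScalar d x y x' y').map f = blockScalar (f d) (f x) (f y) (f x') (f y') := by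
  ext i j
  fin_cases i <;> fin_cases j <;> simp [blockScalar]

omit [NumberField k] in
/-- transport of a torus element along a ring homomorphism: the rational `tmat` read in `R` -/
theorem tmat_map {R : Type} [CommRing R] (D : TorusData k) (ι : k →+* R) (ρ : Fin 4 → k) :
    (D.tmat (RingHom.id k) ρ).map ι = D.tmat ι (fun i => ι (ρ i)) := by
  have hid : ∀ A : Matrix (Fin 4) (Fin 4) k, (A.map (RingHom.id k)).map ι = A.map ι := by
    intro A
    ext i j
    simp
  simp only [TorusData.tmat, Matrix.map_mul, Matrix.transpose_map, blockScalar_map, hid,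
    RingHom.id_apply]

omit [NumberField k] in
/-- a rational norm-one pair, read in `R`, has norm one -/
theorem isNormOne_map {R : Type} [CommRing R] (ι : k →+* R) {d : k} {ρ : Fin 4 → k}
    (hρ : TorusData.IsNormOne d ρ) : TorusData.IsNormOne (ι d) (fun i => ι (ρ i)) := by
  obtain ⟨h1, h2⟩ := hρ
  refine ⟨?_, ?_⟩
  · have := congrArg ι h1
    simpa only [map_add, map_mul, map_one] using this
  · have := congrArg ι h2
    simpa only [map_add, map_mul, map_one] using this

variable {P : Fin 2 → Matrix (Fin 4) (Fin 4) k}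

/-- **every element of the torus is `tmat` of a pair of norm-one scalars**: for `D` the torus data of the plane
(`D.B = B`, `D.Om = Ωᵀ`, `D.P = (P 0)ᵀ`) and `g ∈ U(W)(𝔸_k)` commuting with `P 0`, `g = tmat ρ` with `ρ` of norm one
(`Rot.torus_scalar_of_isometry` in the column picture `M = gᵀ`). -/
theorem exists_pair_of_mem (D : TorusData k) (hDB : D.B = W.B) (hDOm : D.Om = W.Ωᵀ)
    (hDP : D.P = (P 0)ᵀ) (g : GA W) (hg0 : g ∈ commutant W (P 0)) :
    ∃ ρ : Fin 4 → Ad k, TorusData.IsNormOne (algebraMap k (Ad k) D.d) ρ ∧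
      GA.mat W g = D.tmat (algebraMap k (Ad k)) ρ := by
  set ι := algebraMap k (Ad k) with hι
  set M : Matrix (Fin 4) (Fin 4) (Ad k) := (GA.mat W g)ᵀ with hMdef
  have hMOm : M * D.Om.map ι = D.Om.map ι * M := by
    have h := ((mem_unitaryGroup W _).mp g.2).1
    simp only [adMat] at h
    rw [hDOm, hMdef, Matrix.transpose_map, ← Matrix.transpose_mul, ← Matrix.transpose_mul, h]
  have hMB : Mᵀ * D.B.map ι * M = D.B.map ι := by
    rw [hDB, hMdef, Matrix.transpose_transpose]
    exact ((mem_unitaryGroup W _).mp g.2).2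
  have hMP : M * D.P.map ι = D.P.map ι * M := by
    have h : GA.mat W g * adMat k (P 0) = adMat k (P 0) * GA.mat W g := hg0
    simp only [adMat] at h
    rw [hDP, hMdef, Matrix.transpose_map, ← Matrix.transpose_mul, ← Matrix.transpose_mul, h]
  obtain ⟨x, y, x', y', hxy, hxy', hM⟩ := torus_scalar_of_isometry ι D.hB D.hherm D.hOm D.hd D.hdef D.hv
    D.hw D.hwv D.hwOv D.hPv D.hPOv D.hPw D.hPOw hMOm hMB hMP
  refine ⟨![x, y, x', y'], ⟨by simpa using hxy, by simpa using hxy'⟩, ?_⟩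
  rw [TorusData.tmat_eq_transpose]
  simp only [Matrix.cons_val_zero, Matrix.cons_val_one, Matrix.head_cons, Matrix.cons_val_two,
    Matrix.tail_cons, Matrix.cons_val_three]
  rw [TorusData.S, ← hM, hMdef, Matrix.transpose_transpose]

/-- the adelic torus element of a norm-one pair, as an element of `GL₄(𝔸_k)` (inverse: the conjugate pair) -/
def torusUnit (D : TorusData k) (ρ : Fin 4 → Ad k)
    (hρ : TorusData.IsNormOne (algebraMap k (Ad k) D.d) ρ) : GL4 k :=
  ⟨D.tmat (algebraMap k (Ad k)) ρ, D.tmat (algebraMap k (Ad k)) (TorusData.pconj ρ),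
    D.tmat_mul_pconj _ ρ hρ, D.tmat_pconj_mul _ ρ hρ⟩

/-- the torus element lies in `U(W)(𝔸_k)` -/
theorem torusUnit_mem (D : TorusData k) (hDB : D.B = W.B) (hDOm : D.Om = W.Ωᵀ) (ρ : Fin 4 → Ad k)
    (hρ : TorusData.IsNormOne (algebraMap k (Ad k) D.d) ρ) : torusUnit D ρ hρ ∈ unitaryGroup W := by
  obtain ⟨h1, h2, -⟩ := D.tmat_props (algebraMap k (Ad k)) ρ hρ
  refine (mem_unitaryGroup W _).mpr ⟨?_, ?_⟩
  · show D.tmat (algebraMap k (Ad k)) ρ * adMat k W.Ω = adMat k W.Ω * D.tmat (algebraMap k (Ad k)) ρ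
    have hΩ : (D.Om.map (algebraMap k (Ad k)))ᵀ = adMat k W.Ω := by
      rw [hDOm, Matrix.transpose_map, Matrix.transpose_transpose]
      rfl
    rw [← hΩ]
    exact h1
  · show D.tmat (algebraMap k (Ad k)) ρ * adMat k W.B * (D.tmat (algebraMap k (Ad k)) ρ)ᵀ = adMat k W.B
    have hB : D.B.map (algebraMap k (Ad k)) = adMat k W.B := by rw [hDB]; rfl
    rw [← hB]
    exact h2

/-- the adelic torus element of a norm-one pair, as an element of `U(W)(𝔸_k)` -/
def torusElt (D : TorusData k) (hDB : D.B = W.B) (hDOm : D.Om = W.Ωᵀ) (ρ : Fin 4 → Ad k)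
    (hρ : TorusData.IsNormOne (algebraMap k (Ad k) D.d) ρ) : GA W :=
  ⟨torusUnit D ρ hρ, torusUnit_mem D hDB hDOm ρ hρ⟩

/-- the matrix of the torus element -/
theorem torusElt_mat (D : TorusData k) (hDB : D.B = W.B) (hDOm : D.Om = W.Ωᵀ) (ρ : Fin 4 → Ad k)
    (hρ : TorusData.IsNormOne (algebraMap k (Ad k) D.d) ρ) :
    GA.mat W (torusElt D hDB hDOm ρ hρ) = D.tmat (algebraMap k (Ad k)) ρ := rfl

/-- the torus element lies in the torus `commutant (P 0) ⊓ commutant (P 1)` -/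
theorem torusElt_mem (D : TorusData k) (hDB : D.B = W.B) (hDOm : D.Om = W.Ωᵀ) (hDP : D.P = (P 0)ᵀ)
    (hP : ProjPair W P) (ρ : Fin 4 → Ad k) (hρ : TorusData.IsNormOne (algebraMap k (Ad k) D.d) ρ) :
    torusElt D hDB hDOm ρ hρ ∈ commutant W (P 0) ⊓ commutant W (P 1) := by
  obtain ⟨-, -, h3⟩ := D.tmat_props (algebraMap k (Ad k)) ρ hρ
  have hP0 : D.tmat (algebraMap k (Ad k)) ρ * adMat k (P 0) =
      adMat k (P 0) * D.tmat (algebraMap k (Ad k)) ρ := by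
    have hPm : (D.P.map (algebraMap k (Ad k)))ᵀ = adMat k (P 0) := by
      rw [hDP, Matrix.transpose_map, Matrix.transpose_transpose]
      rfl
    rw [← hPm]
    exact h3
  refine ⟨hP0, ?_⟩
  show D.tmat (algebraMap k (Ad k)) ρ * adMat k (P 1) = adMat k (P 1) * D.tmat (algebraMap k (Ad k)) ρ
  have hP1 : adMat k (P 1) = 1 - adMat k (P 0) := by
    rw [← adMat_one (k := k), ← hP.sum, adMat_add]
    abel
  rw [hP1, mul_sub, sub_mul, mul_one, one_mul, hP0]

/-- the torus elements multiply like the pairs -/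
theorem torusElt_mul (D : TorusData k) (hDB : D.B = W.B) (hDOm : D.Om = W.Ωᵀ) (ρ ρ' : Fin 4 → Ad k)
    (hρ : TorusData.IsNormOne (algebraMap k (Ad k) D.d) ρ)
    (hρ' : TorusData.IsNormOne (algebraMap k (Ad k) D.d) ρ') :
    torusElt D hDB hDOm (TorusData.pmul (algebraMap k (Ad k) D.d) ρ ρ')
        (TorusData.isNormOne_pmul _ ρ ρ' hρ hρ') =
      torusElt D hDB hDOm ρ hρ * torusElt D hDB hDOm ρ' hρ' := by
  apply Subtype.ext
  apply Units.ext
  show D.tmat (algebraMap k (Ad k)) (TorusData.pmul (algebraMap k (Ad k) D.d) ρ ρ') =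
    D.tmat (algebraMap k (Ad k)) ρ * D.tmat (algebraMap k (Ad k)) ρ'
  exact (D.tmat_mul _ ρ ρ').symm

/-- the torus element of a RATIONAL norm-one pair is a rational point -/
theorem torusElt_mem_rationalPoints (D : TorusData k) (hDB : D.B = W.B) (hDOm : D.Om = W.Ωᵀ)
    (ρ : Fin 4 → k) (hρ : TorusData.IsNormOne D.d ρ) :
    torusElt D hDB hDOm (fun i => algebraMap k (Ad k) (ρ i)) (isNormOne_map _ hρ) ∈
      rationalPoints W := by
  rw [rationalPoints, Subgroup.mem_subgroupOf, principalGL, MonoidHom.mem_range]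
  refine ⟨⟨D.tmat (RingHom.id k) ρ, D.tmat (RingHom.id k) (TorusData.pconj ρ),
    D.tmat_mul_pconj _ ρ hρ, D.tmat_pconj_mul _ ρ hρ⟩, ?_⟩
  apply Units.ext
  show (RingHom.mapMatrix (algebraMap k (Ad k))) (D.tmat (RingHom.id k) ρ) =
    D.tmat (algebraMap k (Ad k)) (fun i => algebraMap k (Ad k) (ρ i))
  rw [RingHom.mapMatrix_apply, tmat_map D]

/-- `ρ ↦ tmat ρ` is continuous -/
theorem continuous_tmat (D : TorusData k) :
    Continuous fun ρ : Fin 4 → Ad k => D.tmat (algebraMap k (Ad k)) ρ := by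
  unfold TorusData.tmat
  refine (continuous_const.matrix_mul ?_).matrix_mul continuous_const
  refine Continuous.matrix_transpose ?_
  refine continuous_matrix fun i j => ?_
  fin_cases i <;> fin_cases j <;> simp only [blockScalar, Matrix.of_apply, Matrix.cons_val',
    Matrix.empty_val', Matrix.cons_val_fin_one] <;> fun_prop

/-- conjugation of pairs is continuous -/
theorem continuous_pconj : Continuous fun ρ : Fin 4 → Ad k => TorusData.pconj ρ := by
  refine continuous_pi fun i => ?_
  fin_cases i <;> simp only [TorusData.pconj] <;> fun_prop

/-- **the torus element is continuous in the pair** (on the closed set of norm-one pairs, into `U(W)(𝔸_k)` with the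
units topology) -/
theorem continuous_torusElt (D : TorusData k) (hDB : D.B = W.B) (hDOm : D.Om = W.Ωᵀ) :
    Continuous fun ρ : {ρ : Fin 4 → Ad k // TorusData.IsNormOne (algebraMap k (Ad k) D.d) ρ} =>
      torusElt D hDB hDOm ρ.1 ρ.2 := by
  refine Continuous.subtype_mk ?_ _
  rw [Units.continuous_iff]
  refine ⟨?_, ?_⟩
  · exact (continuous_tmat D).comp continuous_subtype_val
  · exact ((continuous_tmat D).comp continuous_pconj).comp continuous_subtype_val

end Elements

section Assembly

variable {W}

/-- **R-c′ for a projector pair — the TORUS BRIDGE**: for a genuine definite plane and a projector pair `P`, the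
torus `T = commutant (P 0) ⊓ commutant (P 1)` is `T(k) · C` with `C ⊆ T` compact.  Proof: every `g ∈ T` is
`torusElt ρ` for a pair `ρ = (x, y, x′, y′)` of norm-one scalars (`exists_pair_of_mem`); hstab rung (ii)
(`normOneTorusCocompact`) writes `(x, y) = γ₀ c₀` and `(x′, y′) = γ₁ c₁` with `γᵢ ∈ k²` of norm one and `cᵢ` in a
compact `C₀ ⊆ 𝔸_k²`; so `g = torusElt (γ₀, γ₁) · torusElt (c₀, c₁)` with the first factor rational
(`torusElt_mem_rationalPoints`) and the second in the image `C` of the compact set of norm-one pairs with both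
halves in `C₀` under the continuous `torusElt` (`continuous_torusElt`). -/
theorem cocompact_rationalOf_commutant_pair (hg : IsGenuineRow W) (hW : IsDefinite W)
    {P : Fin 2 → Matrix (Fin 4) (Fin 4) k} (hP : ProjPair W P) :
    ∃ C : Set (commutant W (P 0) ⊓ commutant W (P 1) : Subgroup (GA W)), IsCompact C ∧
      ∀ x : (commutant W (P 0) ⊓ commutant W (P 1) : Subgroup (GA W)),
        ∃ γ : rationalOf W (commutant W (P 0) ⊓ commutant W (P 1)), ∃ c ∈ C,
          x = (γ : (commutant W (P 0) ⊓ commutant W (P 1) : Subgroup (GA W))) * c := by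
  classical
  obtain ⟨⟨d, hΩ, hd⟩, hrow, -, -, -, -⟩ := hg
  obtain ⟨v, hv, hv0⟩ := exists_row_ne_zero (hP.rank 0) (hP.idem 0)
  obtain ⟨w, hw, hw1⟩ := exists_row_ne_zero (hP.rank 1) (hP.idem 1)
  set D : TorusData k := planeTorusData W hW hΩ hd hrow hP hv hw hv0 hw1 with hDdef
  have hDB : D.B = W.B := rfl
  have hDOm : D.Om = W.Ωᵀ := rfl
  have hDP : D.P = (P 0)ᵀ := rfl
  have hDd : D.d = d := rfl
  haveI := t2Space_adeleRing k
  -- hstab rung (ii)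
  obtain ⟨C₀, hC₀, hcov⟩ := normOneTorusCocompact d hd
  -- the compact set of norm-one pairs with both halves in `C₀`
  set N : Set (Fin 4 → Ad k) := {ρ | TorusData.IsNormOne (algebraMap k (Ad k) D.d) ρ} with hNdef
  have hN : IsClosed N := by
    have h1 : IsClosed {ρ : Fin 4 → Ad k | ρ 0 * ρ 0 + algebraMap k (Ad k) D.d * (ρ 1 * ρ 1) = 1} :=
      isClosed_eq (by fun_prop) continuous_const
    have h2 : IsClosed {ρ : Fin 4 → Ad k | ρ 2 * ρ 2 + algebraMap k (Ad k) D.d * (ρ 3 * ρ 3) = 1} :=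
      isClosed_eq (by fun_prop) continuous_const
    exact h1.inter h2
  set K : Set (Fin 4 → Ad k) :=
    (fun p : (Fin 2 → Ad k) × (Fin 2 → Ad k) => ![p.1 0, p.1 1, p.2 0, p.2 1]) '' (C₀ ×ˢ C₀) with hKdef
  have hK : IsCompact K := by
    refine (hC₀.prod hC₀).image ?_
    refine continuous_pi fun i => ?_
    fin_cases i <;> fun_prop
  have hKN : IsCompact ((Subtype.val : N → (Fin 4 → Ad k)) ⁻¹' K) :=
    hN.isClosedEmbedding_subtypeVal.isCompact_preimage hK
  let Φ : N → (commutant W (P 0) ⊓ commutant W (P 1) : Subgroup (GA W)) := fun ρ =>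
    ⟨torusElt D hDB hDOm ρ.1 ρ.2, torusElt_mem D hDB hDOm hDP hP ρ.1 ρ.2⟩
  have hΦ : Continuous Φ := (continuous_torusElt D hDB hDOm).subtype_mk _
  refine ⟨Φ '' (Subtype.val ⁻¹' K), hKN.image hΦ, ?_⟩
  intro x
  obtain ⟨ρ, hρ, hρx⟩ := exists_pair_of_mem D hDB hDOm hDP (x : GA W) x.2.1
  have hx : (x : GA W) = torusElt D hDB hDOm ρ hρ := Subtype.ext (Units.ext hρx)
  -- rung (ii) on the two scalars
  obtain ⟨γ₀, hγ₀, c₀, hc₀C, hc₀N, h₀⟩ := hcov ![ρ 0, ρ 1] (by simpa [qnorm, hDd] using hρ.1)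
  obtain ⟨γ₁, hγ₁, c₁, hc₁C, hc₁N, h₁⟩ := hcov ![ρ 2, ρ 3] (by simpa [qnorm, hDd] using hρ.2)
  set γ : Fin 4 → k := ![γ₀ 0, γ₀ 1, γ₁ 0, γ₁ 1] with hγdef
  set c : Fin 4 → Ad k := ![c₀ 0, c₀ 1, c₁ 0, c₁ 1] with hcdef
  have hγN : TorusData.IsNormOne D.d γ := by
    refine ⟨?_, ?_⟩
    · simpa [qnorm, γ, hDd] using hγ₀
    · simpa [qnorm, γ, hDd] using hγ₁
  have hcN : TorusData.IsNormOne (algebraMap k (Ad k) D.d) c := by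
    refine ⟨?_, ?_⟩
    · simpa [qnorm, c, hDd] using hc₀N
    · simpa [qnorm, c, hDd] using hc₁N
  have hρeq : ρ = TorusData.pmul (algebraMap k (Ad k) D.d) (fun i => algebraMap k (Ad k) (γ i)) c := by
    funext i
    fin_cases i
    · have := congrFun h₀ 0
      simp [qmul, qrat] at this
      simpa [TorusData.pmul, γ, c, hDd] using this
    · have := congrFun h₀ 1
      simp [qmul, qrat] at this
      simpa [TorusData.pmul, γ, c, hDd] using this
    · have := congrFun h₁ 0
      simp [qmul, qrat] at this
      simpa [TorusData.pmul, γ, c, hDd] using this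
    · have := congrFun h₁ 1
      simp [qmul, qrat] at this
      simpa [TorusData.pmul, γ, c, hDd] using this
  have hcK : (⟨c, hcN⟩ : N) ∈ (Subtype.val : N → (Fin 4 → Ad k)) ⁻¹' K :=
    ⟨(c₀, c₁), ⟨hc₀C, hc₁C⟩, rfl⟩
  refine ⟨⟨⟨torusElt D hDB hDOm (fun i => algebraMap k (Ad k) (γ i)) (isNormOne_map (algebraMap k (Ad k)) hγN),
    torusElt_mem D hDB hDOm hDP hP _ _⟩, ?_⟩, Φ ⟨c, hcN⟩, ⟨⟨c, hcN⟩, hcK, rfl⟩, ?_⟩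
  · rw [rationalOf, Subgroup.mem_subgroupOf]
    exact torusElt_mem_rationalPoints D hDB hDOm γ hγN
  · apply Subtype.ext
    rw [Subgroup.coe_mul, hx]
    show torusElt D hDB hDOm ρ hρ =
      torusElt D hDB hDOm (fun i => algebraMap k (Ad k) (γ i)) (isNormOne_map (algebraMap k (Ad k)) hγN) * torusElt D hDB hDOm c hcN
    rw [← torusElt_mul]
    congr 1

end Assembly

section Instances

/-- **(I1-c′) in cocompactness form — R-c′**: `torusT W = torusT(k) · C` with `C` compact. -/
theorem cocompact_rationalOf_torusT (hg : IsGenuineRow W) (hW : IsDefinite W) :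
    ∃ C : Set (torusT W), IsCompact C ∧ ∀ x : torusT W, ∃ γ : rationalOf W (torusT W), ∃ c ∈ C,
      x = (γ : torusT W) * c :=
  cocompact_rationalOf_commutant_pair hg hW (projPair_P W hg)

/-- **(I1-c″) in cocompactness form — R-c″**: `torusT' W = torusT'(k) · C` with `C` compact. -/
theorem cocompact_rationalOf_torusT' (hg : IsGenuineRow W) (hW : IsDefinite W) :
    ∃ C : Set (torusT' W), IsCompact C ∧ ∀ x : torusT' W, ∃ γ : rationalOf W (torusT' W), ∃ c ∈ C,
      x = (γ : torusT' W) * c :=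
  cocompact_rationalOf_commutant_pair hg hW (projPair_Q W hg)

/-- **(I1-c′) CLOSED, with the disclosed binder `hg : IsGenuineRow W`** (the skeleton's `torus_quotient_compact`,
Skeleton v0.26 L668, whose `IsDefinite`-only form is the junk-plane statement `[O(B)]` compact): `[T] = T(k)\T(𝔸_k)`
is compact — through p5-g0's reduction `torus_quotient_compact_of_cocompact` (CocompactReduction p664429). -/
theorem torus_quotient_compact_of_genuine (hW : IsDefinite W) (hg : IsGenuineRow W)
    [MeasurableSpace (GA W)] [BorelSpace (GA W)] (μT : Measure (torusT W)) [μT.IsHaarMeasure] :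
    ∃ D : Set (torusT W), IsFundamentalDomain (rationalOf W (torusT W)) D μT ∧ IsCompact (closure D) :=
  torus_quotient_compact_of_cocompact W μT (cocompact_rationalOf_torusT W hg hW)

/-- **(I1-c″) CLOSED, with the disclosed binder `hg : IsGenuineRow W`** (the skeleton's `torus'_quotient_compact`,
Skeleton v0.26 L674): `[T′] = T′(k)\T′(𝔸_k)` is compact. -/
theorem torus'_quotient_compact_of_genuine (hW : IsDefinite W) (hg : IsGenuineRow W)
    [MeasurableSpace (GA W)] [BorelSpace (GA W)] (μT' : Measure (torusT' W)) [μT'.IsHaarMeasure] :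
    ∃ D : Set (torusT' W), IsFundamentalDomain (rationalOf W (torusT' W)) D μT' ∧ IsCompact (closure D) :=
  torus'_quotient_compact_of_cocompact W μT' (cocompact_rationalOf_torusT' W hg hW)

end Instances

end Summit.Ventures.HodgeRepro.Tier4.Line1

end
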